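import Mathlib
import Summits.PneNP.PneNP.Theorems.RamseyNotNP.Negative.ComplementSymmetry
import Literature.Computability.MetaComplexity.ProofSystems
import Literature.Computability.MetaComplexity.ProofSystemsProofs

/-!
# Crux `RamseyNotNP` (stmt-PneNP-9814) — wall-breaker strategist, pass p1: the DOOR TEST, kernel-checked

Companion certificate of `Cruxes/RamseyNotNP/STRATEGY-CENSUS.md` (v2, §1 "The door test").
X := `Summit.PneNP.PneNP.Theses.RamseyUncertifiable.RamseyNotNP` (RAMSEY₂ ∉ NP).

An ADMISSIBLE line / decomposition for X needs ≥ 2 open stubs `A, B` with `A ∧ B → X` kernel-checked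
and neither stub summit-strength on its own (dead-line dossier `Lines/Sketch-dead.md` §1–§3, triage
rule (iv)).  This file proves the logical constraint every such pair obeys:

* §1 `band` (**BAND LEMMA**): if the FAILURE of the summit implies `B` (`¬PneNP → B`), then any cut
  `A → B → X` makes `A` alone prove the summit (`A → PneNP`).  Ingredients: `¬PneNP → ¬X`
  (`not_ramseyNotNP_of_not_pneNP`: RAMSEY₂ ∈ P ⊆ NP, from the landed
  `Negative.ramseyLang_thr_mem_P_of_not_pneNP`) and nothing else.  Dually (`summit_of_imp_crux`) a
  conjunct implying X is summit-strength (landed `closes` + `ramseyInCoNP_proof`).  `band_sharp`: the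
  lemma is tight — `X ↔ PneNP ∧ (PneNP → X)` and the residue `PneNP → X` IS implied by `¬PneNP`.
* §2 the conjuncts `B` that the summit's failure implies, typed over tree declarations — each therefore
  USELESS as a line stub unless its partner is the summit: (B1) search-to-decision
  `RAMSEY₂ ∈ NP → RAMSEY₂ ∈ P`; (B2) the collapse `coNP = P`; (B3) NON-P-IMMUNITY = "an infinite
  polynomial-time family of optimal Ramsey graphs exists" (Erdős' explicit-construction problem, in its
  weakest feasible form: under `¬PneNP` the whole language is such a family); (B4) "RAMSEY₂ has a
  polynomially bounded, hence OPTIMAL, certifier" (the existence half of the optimality cut; ideator-4 Q2);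
  (B5) every RE-BASING implication `¬X → C` whose conclusion `C` the collapse makes true (shape of
  ideator-4 Q1 / Feige–Kilian: `C` := "3-TAUT ∈ NTIME(2^{o(m)})", or `C` := `AM = NP`-type
  derandomisation consequences) — its partner `¬C` is summit-strength outright (`band_b5`).
* §3 `partition_collapse`: splitting X = "every verifier fails" along a property `Π` of verifiers gives
  two halves `A_Π ∧ A_{¬Π}`; if every successful Π-verifier is matched by a successful non-Π verifier
  (resource classes: pad the clock / ignore extra certificate bits), the non-Π half alone is X.
* §4 `weakening_split_iff`: for ANY cut whose first conjunct is a consequence of X,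
  `(A ∧ B) ↔ (X ∧ B)` — the shape the r2 triage certified for the optimality cut is generic to every
  (weakening, amplifier) split; what decides admissibility is whether the amplifier `B` has proof
  technology (census §1, §4).

0 `sorry`; axioms: propext, Classical.choice, Quot.sound.  Strategist seat
planner-cstrat-stmt-PneNP-9814-p1-0, 2026-08-17.  `eval_mono` / `simulates_of_isPolyBounded` are copied
(credited) from ideator 5's `SketchIdeator5.lean` (`opt_of_isPolyBounded`), which is not an importable module.
-/

-- `Summit.PneNP.PneNP.…` duplicates `PneNP` BY DESIGN (single-problem summit, D-0017).
set_option linter.dupNamespace false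

namespace Summit.PneNP.PneNP.Cruxes.RamseyNotNP.WallBreaker

open Literature.Computability.Complexity Literature.Computability.Complexity.Nondeterministic
open Literature.Computability.MetaComplexity
open Summit.PneNP.PneNP.Theses.RamseyUncertifiable (RamseyNotNP RamseyInCoNP closes)
open Summit.PneNP.PneNP.Theorems.RamseyNotNP.Negative

/-! ## §1 The band lemma -/

/-- The summit's failure refutes the crux: `¬PneNP → RAMSEY₂ ∈ P ⊆ NP`. [folklore] -/
theorem not_ramseyNotNP_of_not_pneNP (h : ¬ PneNP) : ¬ RamseyNotNP :=
  fun hX => hX (P_subset_NP_holds (ramseyLang_thr_mem_P_of_not_pneNP h))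

/-- The crux proves the summit (the route's deciding theorem `closes` with the landed support
`Summit.PneNP.PneNP.Theorems.ramseyInCoNP_proof`). [folklore] -/
theorem pneNP_of_ramseyNotNP (hX : RamseyNotNP) : PneNP :=
  closes hX Summit.PneNP.PneNP.Theorems.ramseyInCoNP_proof

/-- **BAND LEMMA, abstract form.** If the failure of `S` yields `B` and refutes `X`, then any cut
`A → B → X` makes `A` alone imply `S`. [folklore] -/
theorem band_abstract {S A B X : Prop} (hB : ¬ S → B) (hcut : A → B → X) (hSX : ¬ S → ¬ X) :
    A → S :=
  fun a => Classical.byContradiction fun hs => hSX hs (hcut a (hB hs))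

/-- **BAND LEMMA for the crux `RamseyNotNP`.** A conjunct `B` implied by `¬PneNP` forces its partner
`A` to be summit-strength. [folklore] -/
theorem band {A B : Prop} (hB : ¬ PneNP → B) (hcut : A → B → RamseyNotNP) : A → PneNP :=
  band_abstract hB hcut not_ramseyNotNP_of_not_pneNP

/-- Symmetric form of `band`. [folklore] -/
theorem band' {A B : Prop} (hA : ¬ PneNP → A) (hcut : A → B → RamseyNotNP) : B → PneNP :=
  band hA fun b a => hcut a b

/-- Dual bookkeeping: a conjunct that implies the crux is summit-strength. [folklore] -/
theorem summit_of_imp_crux {A : Prop} (h : A → RamseyNotNP) : A → PneNP :=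
  fun a => pneNP_of_ramseyNotNP (h a)

/-- **The band lemma is sharp**: `X` is the summit plus the residue `PneNP → X` … [folklore] -/
theorem band_sharp : RamseyNotNP ↔ (PneNP ∧ (PneNP → RamseyNotNP)) :=
  ⟨fun hX => ⟨pneNP_of_ramseyNotNP hX, fun _ => hX⟩, fun h => h.2 h.1⟩

/-- … and the residue is implied by the summit's failure, so `band` applies to this very split with
`A := PneNP`. [folklore] -/
theorem residue_of_not_pneNP (h : ¬ PneNP) : PneNP → RamseyNotNP := fun hs => absurd hs h

/-! ## §2 Conjuncts implied by the summit's failure (each needs a summit-strength partner) -/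

/-- (B1) Search-to-decision / "if Ramsey-ness is certifiable it is decidable". [folklore] -/
theorem b1_searchToDecision (h : ¬ PneNP) :
    ramseyLangAt thr ∈ Nondeterministic.NP → ramseyLangAt thr ∈ Classes.P :=
  fun _ => ramseyLang_thr_mem_P_of_not_pneNP h

/-- Band corollary of (B1). [folklore] -/
theorem band_b1 {A : Prop}
    (hcut : A → (ramseyLangAt thr ∈ Nondeterministic.NP → ramseyLangAt thr ∈ Classes.P) →
      RamseyNotNP) :
    A → PneNP :=
  band b1_searchToDecision hcut

/-- (B2) The collapse `coNP = P` (landed `coNP_eq_P_of_not_pneNP`). [folklore] -/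
theorem b2_collapse (h : ¬ PneNP) : coNP = Classes.P := coNP_eq_P_of_not_pneNP h

/-- (B3) NON-P-IMMUNITY — an infinite polynomial-time decidable family of threshold-Ramsey graphs
exists (the feasible form of Erdős' explicit-construction problem at the optimal constant): implied by
the summit's FAILURE, witnessed by the whole language (landed `ramseyLang_thr_infinite`). [folklore] -/
theorem b3_explicitFamily (h : ¬ PneNP) :
    ∃ S : Language Bool, S ∈ Classes.P ∧ S ≤ ramseyLangAt thr ∧
      (S : Set (List Bool)).Infinite :=
  ⟨ramseyLangAt thr, ramseyLang_thr_mem_P_of_not_pneNP h, le_rfl, ramseyLang_thr_infinite⟩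

/-- Band corollary of (B3): an explicit optimal Ramsey family can never be a line stub toward X with a
non-summit partner. [folklore] -/
theorem band_b3 {A : Prop}
    (hcut : A → (∃ S : Language Bool, S ∈ Classes.P ∧ S ≤ ramseyLangAt thr ∧
      (S : Set (List Bool)).Infinite) → RamseyNotNP) :
    A → PneNP :=
  band b3_explicitFamily hcut

/-- (B4a) Under the collapse RAMSEY₂ has a polynomially bounded proof system (Cook–Reckhow, tree fact
`hasPolyBoundedProofSystem_iff_mem_NP_holds`). [folklore] -/
theorem b4_polyBounded (h : ¬ PneNP) : HasPolyBoundedProofSystem (ramseyLangAt thr) :=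
  (hasPolyBoundedProofSystem_iff_mem_NP_holds (L := ramseyLangAt thr)).2
    (P_subset_NP_holds (ramseyLang_thr_mem_P_of_not_pneNP h))

/-- Evaluation of an `ℕ`-polynomial is monotone (copied from ideator 5's `SketchIdeator5.lean`). [folklore] -/
private theorem eval_mono (r : Polynomial ℕ) {a b : ℕ} (hab : a ≤ b) : r.eval a ≤ r.eval b := by
  rw [Polynomial.eval_eq_sum_range, Polynomial.eval_eq_sum_range]
  exact Finset.sum_le_sum fun i _ => Nat.mul_le_mul_left _ (Nat.pow_le_pow_left hab i)

/-- A polynomially bounded proof system for `L` simulates every proof system for `L` (ideator 5's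
`opt_of_isPolyBounded`, language-generic). [folklore] -/
theorem simulates_of_isPolyBounded {L : Language Bool} {Q W : List Bool → List Bool → Bool}
    (hQ : IsProofSystemFor Q L) (hb : IsPolyBounded Q) (hW : IsProofSystemFor W L) :
    Simulates Q W := by
  obtain ⟨p, hp⟩ := hb
  refine ⟨p, fun x π hπ => ?_⟩
  have hx : x ∈ L := (hW.2 x).2 ⟨π, hπ⟩
  obtain ⟨π₀, hπ₀⟩ := (hQ.2 x).1 hx
  obtain ⟨π', hlen, hacc⟩ := hp x π₀ hπ₀
  exact ⟨π', hlen.trans (eval_mono p (Nat.le_add_right _ _)), hacc⟩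

/-- (B4) "RAMSEY₂ HAS AN OPTIMAL CERTIFIER" (the existence half of the optimality cut; ideator-4 Q2 /
Krajíček 2019 Problem 1.5.5 for RAMSEY₂) is implied by the summit's failure. [folklore] -/
theorem b4_optimalCertifier (h : ¬ PneNP) :
    ∃ Q, IsProofSystemFor Q (ramseyLangAt thr) ∧
      ∀ W, IsProofSystemFor W (ramseyLangAt thr) → Simulates Q W := by
  obtain ⟨Q, hQ, hb⟩ := b4_polyBounded h
  exact ⟨Q, hQ, fun W hW => simulates_of_isPolyBounded hQ hb hW⟩

/-- Band corollary of (B4): "some optimal Ramsey certifier exists" can only be paired with a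
summit-strength stub (consistent with ideator 5's dichotomy `X ↔ every optimal certifier is hard`).
[folklore] -/
theorem band_b4 {A : Prop}
    (hcut : A → (∃ Q, IsProofSystemFor Q (ramseyLangAt thr) ∧
      ∀ W, IsProofSystemFor W (ramseyLangAt thr) → Simulates Q W) → RamseyNotNP) :
    A → PneNP :=
  band b4_optimalCertifier hcut

/-- (B5) RE-BASING implications.  If the collapse makes `C` true, then the re-basing statement
`¬X → C` ("a Ramsey certifier would yield C") is implied by the collapse … [folklore] -/
theorem b5_rebasing {C : Prop} (hC : ¬ PneNP → C) (h : ¬ PneNP) : ¬ RamseyNotNP → C :=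
  fun _ => hC h

/-- … so in the cut `(¬X → C) → ¬C → X` the partner `¬C` is summit-strength outright: re-basing X on a
hypothesis `¬C` refuted by `P = NP` (coNETH, NSETH-type statements, `AM ≠ NP`, …) can upgrade the
route's STANDING (conditional bridge) but can never supply an admissible two-stub line. [folklore] -/
theorem band_b5 {C : Prop} (hC : ¬ PneNP → C) : ¬ C → PneNP :=
  fun hnc => Classical.byContradiction fun hs => hnc (hC hs)

/-- The re-basing cut itself is valid bookkeeping (recorded so that §2 (B5) is about a real cut). [folklore] -/
theorem rebasing_cut {C : Prop} (hre : ¬ RamseyNotNP → C) (hnc : ¬ C) : RamseyNotNP :=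
  Classical.byContradiction fun hX => hnc (hre hX)

/-! ## §3 Partition splits of "every verifier fails" -/

/-- **Partition collapse.**  Split the verifiers `V` by a property `P`; `good v` := "`v` is a sound and
complete polynomial-time Ramsey certifier" (abstract here).  If every good `P`-verifier is matched by a
good non-`P` verifier (true for every RESOURCE property: a slower clock or a longer, ignored
certificate simulates the restricted verifier), then the non-`P` half of the split `(∀ P-verifiers
fail) ∧ (∀ non-P verifiers fail)` is already the whole statement. [folklore] -/
theorem partition_collapse {V : Type*} (P good : V → Prop)
    (hsim : ∀ v, P v → good v → ∃ w, ¬ P w ∧ good w) (hco : ∀ w, ¬ P w → ¬ good w) :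
    ∀ v, ¬ good v := by
  intro v hv
  by_cases hp : P v
  · obtain ⟨w, hw, hgw⟩ := hsim v hp hv
    exact hco w hw hgw
  · exact hco v hp hv

/-- The split itself is exact (both halves together are the statement). [folklore] -/
theorem partition_split_iff {V : Type*} (P good : V → Prop) :
    (∀ v, ¬ good v) ↔ (∀ v, P v → ¬ good v) ∧ (∀ v, ¬ P v → ¬ good v) :=
  ⟨fun h => ⟨fun v _ => h v, fun v _ => h v⟩,
    fun h v hv => (Classical.em (P v)).elim (fun hp => h.1 v hp hv) (fun hn => h.2 v hn hv)⟩

/-! ## §4 The (weakening, amplifier) normal form -/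

/-- For ANY cut whose first conjunct `A` is a consequence of `X`, the stub set is `X` plus the
amplifier: `(A ∧ B) ↔ (X ∧ B)`.  (The r2 triage certified this for `A := Hard Q`, `B := Opt Q`; it is
generic — so it cannot by itself separate admissible from inadmissible splits; the census's criterion
is whether `B` has proof technology.) [folklore] -/
theorem weakening_split_iff {A B X : Prop} (hXA : X → A) (hcut : A → B → X) :
    (A ∧ B) ↔ (X ∧ B) :=
  ⟨fun h => ⟨hcut h.1 h.2, h.2⟩, fun h => ⟨hXA h.1, h.2⟩⟩

/-- With the extra fact that the FAILURE of the weakening yields the amplifier (as for the optimality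
cut: a p-bounded `Q` is optimal), one conjunct is free in every world: `A ∨ B`. [folklore] -/
theorem weakening_or_amplifier {A B : Prop} (hnA : ¬ A → B) : A ∨ B := by
  by_cases hA : A
  · exact Or.inl hA
  · exact Or.inr (hnA hA)

end Summit.PneNP.PneNP.Cruxes.RamseyNotNP.WallBreaker
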